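import Summits.QuantumFields.YangMills.Theorems.LuscherReductionDressedRitzPolyakovLiftDefs
import Summits.QuantumFields.YangMills.Theorems.LuscherReductionDressedRitzVacuumDictionaryLimits
import Summits.QuantumFields.YangMills.Theorems.LuscherReductionDressedRitzPolyakovLiftStaticsPrep
import HarnessLib

/-!
# Route `LuscherReduction`, item `DressedRitz` (stmt-QuantumFields-20205), line «polyakovlift» — RAW VACUA ARE `±Ω`: every `IsRawVacuum β φ` is the
# Perron–Frobenius vacuum up to sign and a null function; the clause groups of the line do not see the difference

Support module of the `FemtoTransferGap` group (fleet service by seat ym-infvol-p2 g6; route `LuscherReduction`, femto rung R2b1; bears on the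
crux child `DressedRitz` = stmt-QuantumFields-20205, line «polyakovlift» of owner ym-beyond-p1 g21).  NEW, fixed lattice.

WHY.  The three registered stubs of «polyakovlift» (`stub_liftStatics ∕ Dynamics ∕ Leakage`; tree texts `PolyakovLift.StaticClauses ∕ DynamicClauses ∕
LeakageClause`, `…PolyakovLiftDefs.lean`) quantify UNIVERSALLY over raw vacua `φ` (`PolyakovLift.IsRawVacuum β φ`: physical, `‖φ‖ = 1`,
`K_βφ = λ₀φ`), so that they speak about the same vectors without a shared choice.  A prover, however, computes with THE Perron–Frobenius vacuum
`Ω ≥ c > 0` (`VacDict.exists_isVacuum`) and the vacuum dictionary (`VacDict.tendsto_ratio ∕ tendsto_feynmanKac`, slabs `Φ_m = K^m 1`, admissible since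
`⟨Ω,1⟩ > 0`).  This file closes the gap once and for all, at fixed lattice, by Jentzsch's gap (`VacDict.IsVacuum.gap`, `θ < λ₀`):

* §1 `sq_eq_one_and_eq` — for a vacuum package `(Ω, θ)` (`VacDict.IsVacuum`) and a raw vacuum `φ`: `⟨φ,Ω⟩² = 1` and `φ = ⟨φ,Ω⟩·Ω`
  EVERYWHERE — a corollary of seat ym-infvol-p1 g5's `rawVacuum_eq_smul_of_gap` (`…PolyakovLiftStaticsPrep.lean`: Jentzsch's gap kills the
  orthogonal part in `L²`, the pointwise eigen-equation upgrades a.e. to everywhere), read against the `VacDict` package.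
* §2 ★ `isVacuum_of_isRawVacuum` — a raw vacuum IS a vacuum package with the same `θ` (so the whole vacuum dictionary applies to it), and
  `l2Form_one_ne_zero_of_isRawVacuum` — `⟨φ, 1⟩ ≠ 0` (the slabs are admissible start vectors for it).
* §3 invariance of the clause DATA under `φ ↦ Ω`: `vev_eq` (`⟨φ, Oφ⟩ = ⟨Ω, OΩ⟩`), `ins_eq_smul` (`ins φ O = a • ins Ω O`, exactly),
  `transferApply_ins_eq`, and the three bilinear data `l2_ins_ins_eq`, `l2_ins_transferApply_ins_eq`, `l2_transferApply_ins_eq`.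
* §4 ★★ `plateauClauses_iff`, `staticClauses_iff`, `dynamicClauses_iff`, `dynamicCoreClauses_iff`, `leakageClause_iff` — each clause group for the
  insertions at a raw vacuum `φ` ⟺ the same at `Ω`: a stub prover may fix `φ := Ω` (PF) and transfer.

HONEST FRAMING: fixed-lattice functional analysis on the femto rung R2b1; proves nothing OF the three RG stubs; no bearing on infinite volume, the
continuum limit or the Clay mass gap.  References: Reed–Simon IV, Thm XIII.43–44 (Jentzsch ∕ Perron–Frobenius) [cite: ReedSimonIV1978, Thm XIII.43];
M. Lüscher, NPB 219 (1983) 233 [cite: Luscher1983, §2].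
-/

set_option autoImplicit false

noncomputable section

open MeasureTheory Filter Topology Real
open Literature.MathematicalPhysics.QuantumFieldTheory (GaugeConfig Site gaugeTransform)
open scoped BigOperators

namespace Summit.QuantumFields.YangMills.Theorems.FemtoTransferGap.PolyakovLift

open Summit.QuantumFields.YangMills.Theorems.FemtoTransferGap
open Summit.QuantumFields.YangMills.Theorems.FemtoTransferGap.PhysL2
open Summit.QuantumFields.YangMills.Theorems.FemtoTransferGap.VacDict

variable {L : ℕ} [NeZero L] {β θ : ℝ} {Ω : physSubmodule L} {φ : GaugeConfig 3 L SU2 → ℝ}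

/-! ## §1 A raw vacuum is `±Ω` (everywhere) -/

/-- **Raw vacua are `±Ω`.**  For a vacuum package `(Ω, θ)` (`VacDict.IsVacuum`: `‖Ω‖ = 1`, `K_βΩ = λ₀Ω`, Jentzsch gap `⟨ψ,K_βψ⟩ ≤ θ‖ψ‖²` on `Ω^⊥`,
`θ < λ₀`) and a raw vacuum `φ` (physical, `‖φ‖ = 1`, `K_βφ = λ₀φ` pointwise): `⟨φ,Ω⟩² = 1` and `φ = ⟨φ,Ω⟩·Ω` everywhere (seat ym-infvol-p1 g5's
`rawVacuum_eq_smul_of_gap`, plus the normalisations). [cite: ReedSimonIV1978, Thm XIII.43] -/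
theorem sq_eq_one_and_eq (hV : IsVacuum β Ω θ) (hφ : IsRawVacuum β φ) :
    l2 φ (Ω : GaugeConfig 3 L SU2 → ℝ) ^ 2 = 1 ∧ ∀ U, φ U = l2 φ (Ω : GaugeConfig 3 L SU2 → ℝ) * (Ω : GaugeConfig 3 L SU2 → ℝ) U := by
  obtain ⟨hφp, hφ1, hKφ⟩ := hφ
  obtain ⟨hΩp, hΩ1, hKΩ⟩ := hV.raw
  rw [levelValue_zero] at hKφ hKΩ
  have hθ : θ < topValue su2Rep L β := by rw [← levelValue_zero]; exact hV.theta_lt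
  have hgap : ∀ ψ : GaugeConfig 3 L SU2 → ℝ, IsPhys ψ → l2 ψ (Ω : GaugeConfig 3 L SU2 → ℝ) = 0 →
      qform su2Rep β ψ ψ ≤ θ * l2 ψ ψ := by
    intro ψ hψ h0
    have h := hV.gap ⟨ψ, hψ⟩ (by rw [l2Form_apply, l2_comm]; exact h0)
    rw [l2Form_apply, l2Form_apply, coe_transferOp, ← qform_eq_l2_transferApply] at h
    exact h
  have hmul := rawVacuum_eq_smul_of_gap β hφp hKφ hΩp hΩ1 hKΩ hθ hgap
  refine ⟨?_, hmul⟩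
  set a : ℝ := l2 φ (Ω : GaugeConfig 3 L SU2 → ℝ)
  have hfun : φ = a • (Ω : GaugeConfig 3 L SU2 → ℝ) := funext fun U => by rw [hmul U, Pi.smul_apply, smul_eq_mul]
  have h1 : l2 φ φ = a * a * l2 (Ω : GaugeConfig 3 L SU2 → ℝ) (Ω : GaugeConfig 3 L SU2 → ℝ) := by
    rw [hfun, OpPlat.l2_smul_smul]
  rw [hφ1, hΩ1, mul_one] at h1
  rw [sq]; exact h1.symm

/-- The raw vacuum as a function: `φ = a • Ω`, `a = ⟨φ,Ω⟩`. [folklore] -/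
theorem eq_smul (hV : IsVacuum β Ω θ) (hφ : IsRawVacuum β φ) :
    φ = l2 φ (Ω : GaugeConfig 3 L SU2 → ℝ) • (Ω : GaugeConfig 3 L SU2 → ℝ) :=
  funext fun U => by rw [(sq_eq_one_and_eq hV hφ).2 U, Pi.smul_apply, smul_eq_mul]

/-! ## §2 A raw vacuum is a vacuum package; the slabs are admissible for it -/

/-- ★ **A raw vacuum IS a vacuum package (same Jentzsch constant `θ`)** — so `VacDict.tendsto_ratio`, `tendsto_onePoint`, `tendsto_twoPoint`,
`tendsto_feynmanKac` apply to it verbatim. [cite: ReedSimonIV1978, Thm XIII.43] -/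
theorem isVacuum_of_isRawVacuum (hV : IsVacuum β Ω θ) (hφ : IsRawVacuum β φ) : IsVacuum β ⟨φ, hφ.1⟩ θ := by
  obtain ⟨hsq, -⟩ := sq_eq_one_and_eq hV hφ
  have hfun := eq_smul hV hφ
  set a : ℝ := l2 φ (Ω : GaugeConfig 3 L SU2 → ℝ) with ha
  refine ⟨?_, ?_, hV.theta_nonneg, hV.theta_lt, fun ψ hψ => ?_⟩
  · rw [l2Form_apply]; exact hφ.2.1
  · apply Subtype.ext
    simp only [coe_transferOp, Submodule.coe_smul]
    exact hφ.2.2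
  · -- `ψ ⊥ φ` ⇒ `ψ ⊥ Ω` (as `⟨φ,ψ⟩ = a⟨Ω,ψ⟩`, `a ≠ 0`)
    have hφψ : l2 φ (ψ : GaugeConfig 3 L SU2 → ℝ) = a * l2 (Ω : GaugeConfig 3 L SU2 → ℝ) ψ := by
      rw [hfun, l2_smul_left]
    have ha0 : a ≠ 0 := by
      intro h; rw [h] at hsq; norm_num at hsq
    have hΩψ : l2Form L Ω ψ = 0 := by
      rw [l2Form_apply] at hψ ⊢
      have : a * l2 (Ω : GaugeConfig 3 L SU2 → ℝ) ψ = 0 := by rw [← hφψ]; exact hψ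
      exact (mul_eq_zero.mp this).resolve_left ha0
    exact hV.gap ψ hΩψ

/-- `⟨φ, 1⟩ ≠ 0` for a raw vacuum (the PF vacuum is uniformly positive, `⟨Ω,1⟩ > 0`, and `φ = ±Ω`): the free-boundary slabs `Φ_m = K^m 1` are
admissible start vectors of the vacuum dictionary at `φ`. [cite: ReedSimonIV1978, Thm XIII.44] -/
theorem l2Form_one_ne_zero_of_isRawVacuum (hV : IsVacuum β Ω θ) {c : ℝ} (hc : 0 < c)
    (hcle : ∀ U, c ≤ (Ω : GaugeConfig 3 L SU2 → ℝ) U) (hφ : IsRawVacuum β φ) :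
    l2Form L ⟨φ, hφ.1⟩ one ≠ 0 := by
  obtain ⟨hsq, -⟩ := sq_eq_one_and_eq hV hφ
  have hfun := eq_smul hV hφ
  have hpos : 0 < l2Form L Ω one := l2Form_vac_one_pos hc hcle
  rw [l2Form_apply] at hpos ⊢
  show l2 φ ((one : physSubmodule L) : GaugeConfig 3 L SU2 → ℝ) ≠ 0
  rw [hfun, l2_smul_left]
  refine mul_ne_zero ?_ hpos.ne'
  intro h; rw [h] at hsq; norm_num at hsq

/-! ## §3 The clause data are blind to the sign -/

section Data

variable (hV : IsVacuum β Ω θ) (hφ : IsRawVacuum β φ)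
include hV hφ

/-- `⟨φ, O·φ⟩ = ⟨Ω, O·Ω⟩` for a raw vacuum `φ` (`φ² = Ω²`). [folklore] -/
theorem vev_eq (O : GaugeConfig 3 L SU2 → ℝ) :
    l2 φ (O * φ) = l2 (Ω : GaugeConfig 3 L SU2 → ℝ) (O * (Ω : GaugeConfig 3 L SU2 → ℝ)) := by
  obtain ⟨hsq, -⟩ := sq_eq_one_and_eq hV hφ
  have hfun := eq_smul hV hφ
  set a : ℝ := l2 φ (Ω : GaugeConfig 3 L SU2 → ℝ)
  have hO' : O * (a • (Ω : GaugeConfig 3 L SU2 → ℝ)) = a • (O * (Ω : GaugeConfig 3 L SU2 → ℝ)) := by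
    funext U
    simp only [Pi.smul_apply, Pi.mul_apply, smul_eq_mul]
    ring
  have haa : a * a = 1 := by rw [← sq]; exact hsq
  rw [hfun, hO', OpPlat.l2_smul_smul, haa, one_mul]

/-- `ins φ O = a • ins Ω O` exactly, `a = ⟨φ,Ω⟩ = ±1`. [folklore] -/
theorem ins_eq_smul (O : GaugeConfig 3 L SU2 → ℝ) :
    OpPlat.ins φ O = l2 φ (Ω : GaugeConfig 3 L SU2 → ℝ) • OpPlat.ins (Ω : GaugeConfig 3 L SU2 → ℝ) O := by
  have hvev := vev_eq hV hφ O
  have hmul := (sq_eq_one_and_eq hV hφ).2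
  funext U
  simp only [OpPlat.ins, Pi.mul_apply, Pi.sub_apply, Pi.smul_apply, smul_eq_mul, hvev]
  rw [hmul U]
  ring

/-- `K_β(ins φ O) = a • K_β(ins Ω O)`. [folklore] -/
theorem transferApply_ins_eq (O : GaugeConfig 3 L SU2 → ℝ) :
    transferApply β (OpPlat.ins φ O) =
      l2 φ (Ω : GaugeConfig 3 L SU2 → ℝ) • transferApply β (OpPlat.ins (Ω : GaugeConfig 3 L SU2 → ℝ) O) := by
  rw [ins_eq_smul hV hφ O, transferApply_smul]

/-- Time-0 data: `⟨ins φ O, ins φ O'⟩ = ⟨ins Ω O, ins Ω O'⟩`. [folklore] -/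
theorem l2_ins_ins_eq (O O' : GaugeConfig 3 L SU2 → ℝ) :
    l2 (OpPlat.ins φ O) (OpPlat.ins φ O') =
      l2 (OpPlat.ins (Ω : GaugeConfig 3 L SU2 → ℝ) O) (OpPlat.ins (Ω : GaugeConfig 3 L SU2 → ℝ) O') := by
  obtain ⟨hsq, -⟩ := sq_eq_one_and_eq hV hφ
  have haa : l2 φ (Ω : GaugeConfig 3 L SU2 → ℝ) * l2 φ (Ω : GaugeConfig 3 L SU2 → ℝ) = 1 := by rw [← sq]; exact hsq
  rw [ins_eq_smul hV hφ O, ins_eq_smul hV hφ O', OpPlat.l2_smul_smul, haa, one_mul]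

/-- Time-1 data: `⟨ins φ O, K_β(ins φ O')⟩ = ⟨ins Ω O, K_β(ins Ω O')⟩`. [folklore] -/
theorem l2_ins_transferApply_ins_eq (O O' : GaugeConfig 3 L SU2 → ℝ) :
    l2 (OpPlat.ins φ O) (transferApply β (OpPlat.ins φ O')) =
      l2 (OpPlat.ins (Ω : GaugeConfig 3 L SU2 → ℝ) O) (transferApply β (OpPlat.ins (Ω : GaugeConfig 3 L SU2 → ℝ) O')) := by
  obtain ⟨hsq, -⟩ := sq_eq_one_and_eq hV hφ
  have haa : l2 φ (Ω : GaugeConfig 3 L SU2 → ℝ) * l2 φ (Ω : GaugeConfig 3 L SU2 → ℝ) = 1 := by rw [← sq]; exact hsq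
  rw [transferApply_ins_eq hV hφ O', ins_eq_smul hV hφ O, OpPlat.l2_smul_smul, haa, one_mul]

/-- Time-2 data: `‖K_β(ins φ O)‖² = ‖K_β(ins Ω O)‖²`. [folklore] -/
theorem l2_transferApply_ins_eq (O : GaugeConfig 3 L SU2 → ℝ) :
    l2 (transferApply β (OpPlat.ins φ O)) (transferApply β (OpPlat.ins φ O)) =
      l2 (transferApply β (OpPlat.ins (Ω : GaugeConfig 3 L SU2 → ℝ) O)) (transferApply β (OpPlat.ins (Ω : GaugeConfig 3 L SU2 → ℝ) O)) := by
  obtain ⟨hsq, -⟩ := sq_eq_one_and_eq hV hφ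
  have haa : l2 φ (Ω : GaugeConfig 3 L SU2 → ℝ) * l2 φ (Ω : GaugeConfig 3 L SU2 → ℝ) = 1 := by rw [← sq]; exact hsq
  rw [transferApply_ins_eq hV hφ O, OpPlat.l2_smul_smul, haa, one_mul]

end Data

/-! ## §4 ★★ The clause groups at a raw vacuum ⟺ at the Perron–Frobenius vacuum -/

section Clauses

variable (hV : IsVacuum β Ω θ) (hφ : IsRawVacuum β φ) {k : ℕ} (C : ℝ) (O : Fin k → (GaugeConfig 3 L SU2 → ℝ))
include hV hφ

/-- ★★ `OpPlat.PlateauClauses` for the insertions `O` at a raw vacuum `φ` ⟺ at `Ω`. [folklore] -/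
theorem plateauClauses_iff :
    OpPlat.PlateauClauses k C β (fun i => OpPlat.ins φ (O i)) ↔
      OpPlat.PlateauClauses k C β (fun i => OpPlat.ins (Ω : GaugeConfig 3 L SU2 → ℝ) (O i)) := by
  unfold OpPlat.PlateauClauses
  simp only [l2_ins_ins_eq hV hφ, l2_ins_transferApply_ins_eq hV hφ, l2_transferApply_ins_eq hV hφ]

/-- `StaticClauses` (time 0) at a raw vacuum ⟺ at `Ω`. [folklore] -/
theorem staticClauses_iff :
    StaticClauses k C β (fun i => OpPlat.ins φ (O i)) ↔ StaticClauses k C β (fun i => OpPlat.ins (Ω : GaugeConfig 3 L SU2 → ℝ) (O i)) := by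
  unfold StaticClauses
  simp only [l2_ins_ins_eq hV hφ]

/-- `DynamicClauses` (time 1) at a raw vacuum ⟺ at `Ω`. [folklore] -/
theorem dynamicClauses_iff :
    DynamicClauses k C β (fun i => OpPlat.ins φ (O i)) ↔ DynamicClauses k C β (fun i => OpPlat.ins (Ω : GaugeConfig 3 L SU2 → ℝ) (O i)) := by
  unfold DynamicClauses
  simp only [l2_ins_ins_eq hV hφ, l2_ins_transferApply_ins_eq hV hφ]

/-- `DynamicCoreClauses` ((o5) ∧ (o6)) at a raw vacuum ⟺ at `Ω`. [folklore] -/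
theorem dynamicCoreClauses_iff :
    DynamicCoreClauses k C β (fun i => OpPlat.ins φ (O i)) ↔
      DynamicCoreClauses k C β (fun i => OpPlat.ins (Ω : GaugeConfig 3 L SU2 → ℝ) (O i)) := by
  unfold DynamicCoreClauses
  simp only [l2_ins_ins_eq hV hφ, l2_ins_transferApply_ins_eq hV hφ]

/-- `LeakageClause` (time 2) at a raw vacuum ⟺ at `Ω`. [folklore] -/
theorem leakageClause_iff :
    LeakageClause k C β (fun i => OpPlat.ins φ (O i)) ↔ LeakageClause k C β (fun i => OpPlat.ins (Ω : GaugeConfig 3 L SU2 → ℝ) (O i)) := by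
  unfold LeakageClause
  simp only [l2_ins_ins_eq hV hφ, l2_ins_transferApply_ins_eq hV hφ, l2_transferApply_ins_eq hV hφ]

end Clauses

end Summit.QuantumFields.YangMills.Theorems.FemtoTransferGap.PolyakovLift

end
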